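import Summits.Parity.GeneralizedHardyLittlewood.Theses.PolymathEpsThreeCeiling
import Literature.NumberTheory.Sieve.PolymathMkEpsCauchySchwarz
import HarnessLib

/-!
# BC3 birth skeleton — crux `GridBoundHigh` (rank 2) of route `PolymathEpsThreeCeiling`
(Parity / GeneralizedHardyLittlewood; item stmt-Parity-19069)

REFRESH (line-writer seat `linewriter-parity-certcluster-1` g0, 2026-08-31) of the pre-open birth skeleton
`pub/parity-ideate/parity-ideate-p3/bc/GridBoundHigh_birth.lean` (sha16 6bac15f016c583b1): the local crux `def` is
replaced by the ROUTE DECL `Summit.Parity.GeneralizedHardyLittlewood.Theses.PolymathEpsThreeCeiling.GridBoundHigh`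
(imported), so that `GridBoundHigh_of` concludes the crux BY NAME; the one open stub is unchanged in content.

LINE.  `GridBoundHigh` (the 24 grid bounds `M_{3,j/80} ≤ 2(80+j)/(81+j)`, `j = 17..40`, for EVERY Polymath test
function `F`)  ⇐  `stub_cwCertsHigh` = for each `j`, an explicit F-INDEPENDENT Cauchy–Schwarz weight certificate
`CWCertAt (j/80) (2(80+j)/(81+j))` (weights `w₀, w₁, w₂` on the enlarged simplex, positive where needed, fibre
budgets `≤ 1`, pointwise sum `≤ M`) — exactly what the cell's exact-rational certificates (kit j240695,
evidence/cw_cert.py, slack ≥ 0.0094) provide as piecewise-constant weights on a rational grid — + the PROVED checker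
`cwChecker` (= the tree's `polymathFunctional_le_of_weights`, Polymath 8b Lemma 6.1 for the ε-enlarged functional,
`n = 2`).  The stub is STRICTLY STRONGER than the crux (a universally quantified analytic inequality is replaced by
the existence of finite certificate data checked by a proved sound checker) — not a restatement.  Proof class:
ccert / kit (24 piecewise-constant weight tables; the fibre-budget integrals `∫ (w m)⁻¹` of step functions are finite
rational sums); the LINE is kit 0.
-/

noncomputable section

open MeasureTheory Set Finset
open Literature.NumberTheory.Sieve

namespace Summit.Parity.GeneralizedHardyLittlewood.Cruxes.GridBoundHigh.Birth

/-- A Cauchy–Schwarz weight certificate for `M_{3,ε} ≤ M` (the F-independent data of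
`polymathFunctional_le_of_weights`, `n = 2`). -/
def CWCertAt (ε M : ℝ) : Prop :=
  ∃ w : Fin 3 → (Fin 3 → ℝ) → ℝ, (∀ m, Measurable (w m)) ∧
    (∀ m (t : Fin 3 → ℝ), 0 < t m → ∑ j ∈ univ.erase m, t j ≤ 1 - ε → 0 < w m t) ∧
    (∀ m (s : Fin 2 → ℝ), (∀ j, 0 ≤ s j) → ∑ j, s j ≤ 1 - ε →
      ∫⁻ u in Ioc (0:ℝ) (1 + ε - ∑ j, s j), ENNReal.ofReal (w m (Fin.insertNth m u s))⁻¹ ≤ 1) ∧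
    (∀ t : Fin 3 → ℝ, (∀ j, 0 ≤ t j) → ∑ j, t j ≤ 1 + ε →
      ∑ m, (if 0 < t m ∧ ∑ j ∈ univ.erase m, t j ≤ 1 - ε then w m t else 0) ≤ M)

/-- Stub statement (the 24 finite certificates): a CW weight certificate at every grid point `j = 17..40`,
SPELLED OUT (`CWCertAt` unfolded). -/
def Signature.stub_cwCertsHigh : Prop :=
  ∀ j : ℕ, 17 ≤ j → j ≤ 40 →
    ∃ w : Fin 3 → (Fin 3 → ℝ) → ℝ, (∀ m, Measurable (w m)) ∧
      (∀ m (t : Fin 3 → ℝ), 0 < t m → ∑ i ∈ univ.erase m, t i ≤ 1 - (j : ℝ) / 80 → 0 < w m t) ∧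
      (∀ m (s : Fin 2 → ℝ), (∀ i, 0 ≤ s i) → ∑ i, s i ≤ 1 - (j : ℝ) / 80 →
        ∫⁻ u in Ioc (0:ℝ) (1 + (j : ℝ) / 80 - ∑ i, s i), ENNReal.ofReal (w m (Fin.insertNth m u s))⁻¹ ≤ 1) ∧
      (∀ t : Fin 3 → ℝ, (∀ i, 0 ≤ t i) → ∑ i, t i ≤ 1 + (j : ℝ) / 80 →
        ∑ m, (if 0 < t m ∧ ∑ i ∈ univ.erase m, t i ≤ 1 - (j : ℝ) / 80 then w m t else 0) ≤
          2 * (80 + (j : ℝ)) / (81 + (j : ℝ)))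

/-- **The open stub** (XL, ccert class): the 24 certificates (exact-rational piecewise-constant weights, kit j240695,
slack ≥ 0.0094), statement SPELLED OUT (definitionally `Signature.stub_cwCertsHigh`, see the `example` below). -/
theorem stub_cwCertsHigh :
    ∀ j : ℕ, 17 ≤ j → j ≤ 40 →
      ∃ w : Fin 3 → (Fin 3 → ℝ) → ℝ, (∀ m, Measurable (w m)) ∧
        (∀ m (t : Fin 3 → ℝ), 0 < t m → ∑ i ∈ univ.erase m, t i ≤ 1 - (j : ℝ) / 80 → 0 < w m t) ∧
        (∀ m (s : Fin 2 → ℝ), (∀ i, 0 ≤ s i) → ∑ i, s i ≤ 1 - (j : ℝ) / 80 →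
          ∫⁻ u in Ioc (0:ℝ) (1 + (j : ℝ) / 80 - ∑ i, s i), ENNReal.ofReal (w m (Fin.insertNth m u s))⁻¹ ≤ 1) ∧
        (∀ t : Fin 3 → ℝ, (∀ i, 0 ≤ t i) → ∑ i, t i ≤ 1 + (j : ℝ) / 80 →
          ∑ m, (if 0 < t m ∧ ∑ i ∈ univ.erase m, t i ≤ 1 - (j : ℝ) / 80 then w m t else 0) ≤
            2 * (80 + (j : ℝ)) / (81 + (j : ℝ))) := by
  sorry

example : Signature.stub_cwCertsHigh := stub_cwCertsHigh

/-- The stub is `CWCertAt` at every grid point (definitional repackaging). -/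
theorem cwCertAt_of_stub (h : Signature.stub_cwCertsHigh) :
    ∀ j : ℕ, 17 ≤ j → j ≤ 40 → CWCertAt ((j : ℝ) / 80) (2 * (80 + j) / (81 + j)) :=
  fun j hj1 hj2 => h j hj1 hj2

/-- **The checker** (PROVED = `polymathFunctional_le_of_weights`): a CW certificate at `(ε, M)`, `M ≥ 0`, bounds the
functional of every test function at `ε`. -/
theorem cwChecker {ε M : ℝ} (hM : 0 ≤ M) (hc : CWCertAt ε M) ⦃F : (Fin 3 → ℝ) → ℝ⦄
    (hF : IsPolymathTestFunction 3 ε F) : polymathFunctional 3 ε F ≤ M := by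
  obtain ⟨w, hw, hpos, hbudget, hpt⟩ := hc
  exact polymathFunctional_le_of_weights (n := 2) hM hF w hw (fun m t _ ht hs => hpos m t ht hs) hbudget hpt

/-- **Composition (kernel-checked)**: the stub gives the ROUTE crux BY NAME, through the proved checker. -/
theorem GridBoundHigh_of :
    Signature.stub_cwCertsHigh →
      Summit.Parity.GeneralizedHardyLittlewood.Theses.PolymathEpsThreeCeiling.GridBoundHigh :=
  fun h j hj1 hj2 F hF => cwChecker (by positivity) (cwCertAt_of_stub h j hj1 hj2) hF

/-- **The skeleton instantiated**: the crux BY NAME modulo the single registered stub (carries exactly its `sorry`). -/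
theorem GridBoundHigh_of_stubs :
    Summit.Parity.GeneralizedHardyLittlewood.Theses.PolymathEpsThreeCeiling.GridBoundHigh :=
  GridBoundHigh_of stub_cwCertsHigh

end Summit.Parity.GeneralizedHardyLittlewood.Cruxes.GridBoundHigh.Birth

end
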